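import Summits.NavierStokesRegularity.NavierStokesRegularity.Theorems.LerayQuarterDissipationFiniteDissipationLiouvilleCalmSliceLocalLeaf
import Mathlib.MeasureTheory.Measure.Haar.NormedSpace
import Mathlib.Analysis.Normed.Module.Ball.Pointwise
import HarnessLib

/-!
# Crux `FiniteDissipationLiouville` (stmt-NavierStokesRegularity-22144): ONE parabolic sub-ball that
# is calm ON AVERAGE (in `L¹`) forces regularity; the flicker of a finite-dissipation Type-I
# singularity carries a definite `L¹`-mass in every sub-ball at every instant

Theorems file of route `LerayQuarterDissipation` (lead prover g14; `--supports` the crux; sequel of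
`…CalmSliceLocalLeaf`). Navier–Stokes regularity is NOT proved by anything here; no summit is.
`𝒟_{C,K}` = Type-I ancient mild fields (KNSS gauge) with the law `∫‖∇w(s)‖² ≤ K/√(−s)`; the
UNSTEADINESS of `w` at `(t,x)` is `√(−t) • ((−t)∂ₜw − ½w − ½(x·∇)w)(t,x)` (`= ∂ₛU(y)`,
`y = x/√(−t)`), so that `(−t)^{−3/2} ∫_{B(x₀, r√(−t))} ‖unsteadiness‖ dx = ∫_{B(c, r)} ‖∂ₛU‖ dy`,
`c = x₀/√(−t)`, is scale invariant.

* `abs_weakUnsteadiness_le_of_meanCalm_ball` — the weak unsteadiness functional of a solenoidal test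
  `ψ` supported in `B(c, r)` is bounded by `‖G‖_{L¹(B(c,r))} · sup‖ψ‖` (`G` the unsteadiness field
  of the slice `−1`): only the MEAN calmness of the ball enters.
* `meanCalm_leaf` — **ONE SUB-BALL CALM ON AVERAGE ⇒ REGULAR**: for all `C, K, ρ, r > 0` there is
  `δ = δ(C,K,ρ,r) > 0` such that a member of `𝒟_{C,K}` with
  `∫_{B(x₀, r√(−t))} ‖unsteadiness(t,x)‖ dx ≤ δ (√(−t))³` for ONE ball with `‖x₀‖ ≤ ρ√(−t)` at ONE
  instant is regular (the sup-calm leaf `CalmSliceLocal.localCalm_leaf` asked `≤ δ` POINTWISE on the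
  ball; compactness as there, the calm bound replaced by the `L¹ × L^∞` bound, the rescaling to the
  slice `−1` by the change of variables `y = x/√(−t)`, `Measure.setIntegral_comp_smul_of_pos`).
* `meanFlicker_floor_of_singular` — PORTRAIT: **the flicker carries DEFINITE `L¹`-MASS EVERYWHERE**:
  for every singular member of `𝒟_{C,K}`, every instant and every centre `‖x₀‖ ≤ ρ√(−t)`,
  `∫_{B(x₀, r√(−t))} ‖unsteadiness‖ > δ(C,K,ρ,r) (√(−t))³`, i.e. `∫_{B(c,r)} ‖∂ₛU‖ dy > δ` in similarity
  variables — the unsteadiness is not merely somewhere large in every sub-ball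
  (`localFlicker_floor_of_singular`) but large on average.

HONEST FRAMING: portrait facts, `δ` ineffective (compactness); nothing removed for the DSS wall; the
crux stays blocked on `∀ c > 1, TypeIDSSLiouville c` (NECESSARY, `…Hardness`).

References: Pineau–Vicol, arXiv:2607.09619 (2026) §1.3; Tsai, ARMA 143 (1998) Thm 1; KNSS,
arXiv:0709.3599 §4.
-/

noncomputable section

-- the summit and its single sub-problem share the name (CONVENTIONS §1), as in every Theorems file
set_option linter.dupNamespace false

namespace Summit.NavierStokesRegularity.NavierStokesRegularity.Theorems.FiniteDissipationLiouville.CalmSliceLocal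

open MeasureTheory Set Filter Topology Metric Function TopologicalSpace InnerProductSpace
open Literature.Analysis Literature.Analysis.FluidPDE
open Summit.NavierStokesRegularity.NavierStokesRegularity.Theorems
open Summit.NavierStokesRegularity.NavierStokesRegularity.Theorems.FiniteDissipationLiouville
open Summit.NavierStokesRegularity.NavierStokesRegularity.Theorems.FiniteDissipationLiouville.CalmSlice
open scoped ENNReal NNReal RealInnerProductSpace Laplacian ContDiff Pointwise

/-! ### Mean calmness bounds the weak unsteadiness -/

/-- **Mean calmness of a ball bounds the weak unsteadiness of the tests supported there.** If
`∫_{B(c,r)} ‖G‖ ≤ η` (`G = ∂ₜw(−1,·) − ½w(−1,·) − ½Dw(−1)[y]`) and the solenoidal test `ψ ∈ C²_c` is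
supported in `B(c, r)` with `‖ψ‖ ≤ M`, then the weak unsteadiness functional of `ψ` is `≤ η M` in
absolute value. [cite: Leray1934, (17) p. 206] -/
theorem abs_weakUnsteadiness_le_of_meanCalm_ball {C : ℝ}
    {w : ℝ → EuclideanSpace ℝ (Fin 3) → EuclideanSpace ℝ (Fin 3)}
    (hw : IsTypeIAncientMild C w) {η r M : ℝ} {c : EuclideanSpace ℝ (Fin 3)}
    (hcalm : ∫ y in ball c r, ‖deriv (fun τ => w τ y) (-1) - (1 / 2 : ℝ) • w (-1) y -
        (1 / 2 : ℝ) • fderiv ℝ (w (-1)) y y‖ ≤ η)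
    {ψ : EuclideanSpace ℝ (Fin 3) → EuclideanSpace ℝ (Fin 3)}
    (hψ : ContDiff ℝ 2 ψ) (hc : HasCompactSupport ψ) (hdiv : VectorCalculus.IsDivFree ψ)
    (hsupp : tsupport ψ ⊆ ball c r) (hM0 : 0 ≤ M) (hM : ∀ y, ‖ψ y‖ ≤ M) :
    |∫ y, (⟪w (-1) y, convect (w (-1)) ψ y⟫ + ⟪w (-1) y, (Δ ψ) y⟫ + ⟪w (-1) y, ψ y⟫ +
        (1 / 2 : ℝ) * ⟪w (-1) y, fderiv ℝ ψ y y⟫)| ≤ η * M := by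
  set G : EuclideanSpace ℝ (Fin 3) → EuclideanSpace ℝ (Fin 3) := fun y =>
    deriv (fun τ => w τ y) (-1) - (1 / 2 : ℝ) • w (-1) y - (1 / 2 : ℝ) • fderiv ℝ (w (-1)) y y
    with hGdef
  have hG : ContDiff ℝ ∞ G := contDiff_unsteadiness hw
  have hGc : Continuous G := hG.continuous
  rw [← integral_inner_unsteadiness_eq hw hψ hc hdiv, ← Real.norm_eq_abs]
  change ‖∫ y, ⟪G y, ψ y⟫‖ ≤ η * M
  -- the integrand vanishes off the ball: restrict to it
  have hzero : ∀ y ∉ ball c r, ⟪G y, ψ y⟫ = 0 := fun y hy => by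
    rw [image_eq_zero_of_notMem_tsupport fun h => hy (hsupp h), inner_zero_right]
  rw [← setIntegral_eq_integral_of_forall_compl_eq_zero (s := ball c r) hzero]
  -- `L¹ × L^∞`
  have hGi : IntegrableOn (fun y => ‖G y‖) (ball c r) volume :=
    ((hGc.norm.continuousOn).integrableOn_compact (isCompact_closedBall c r)).mono_set
      ball_subset_closedBall
  calc ‖∫ y in ball c r, ⟪G y, ψ y⟫‖
      ≤ ∫ y in ball c r, ‖G y‖ * M := by
        refine norm_integral_le_of_norm_le (hGi.mul_const M) (Eventually.of_forall fun y => ?_)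
        exact (norm_inner_le_norm _ _).trans (mul_le_mul_of_nonneg_left (hM y) (norm_nonneg _))
    _ = (∫ y in ball c r, ‖G y‖) * M := integral_mul_const M _
    _ ≤ η * M := mul_le_mul_of_nonneg_right hcalm hM0

/-! ### One sub-ball calm on average ⇒ regular apex -/

/-- **ONE PARABOLIC SUB-BALL CALM ON AVERAGE ⇒ REGULAR APEX.** For all `C, K`, every similarity
radius `ρ` and every sub-ball radius `r > 0` there is `δ > 0` such that: a Type-I ancient mild
field `w` (constant `C`) with the finite-dissipation law (constant `K`) whose unsteadiness
`√(−t)((−t)∂ₜw − ½w − ½(x·∇)w)` has `∫_{B(x₀, r√(−t))} ‖·‖ dx ≤ δ (√(−t))³` for ONE ball with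
`‖x₀‖ ≤ ρ√(−t)` at ONE instant `t < 0` is bounded on some backward parabolic cylinder at the origin
(compactness as in `localCalm_leaf`; the change of variables `y = x/√(−t)` turns the hypothesis into
`∫_{B(c,r)} ‖G‖ ≤ δ` for the rescaled member). [cite: Tsai1998, Theorem 1 (p. 31)] -/
theorem meanCalm_leaf (C K ρ r : ℝ) (hr : 0 < r) : ∃ δ > 0,
    ∀ (w : ℝ → EuclideanSpace ℝ (Fin 3) → EuclideanSpace ℝ (Fin 3)),
      IsTypeIAncientMild C w →
      (∀ s : ℝ, s < 0 → ∫⁻ x, ‖fderiv ℝ (w s) x‖ₑ ^ 2 ≤ ENNReal.ofReal (K / Real.sqrt (-s))) →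
      ∀ t < 0, ∀ x₀ : EuclideanSpace ℝ (Fin 3), ‖x₀‖ ≤ ρ * Real.sqrt (-t) →
      (∫ x in ball x₀ (r * Real.sqrt (-t)),
        ‖Real.sqrt (-t) • ((-t) • deriv (fun τ => w τ x) t - (1 / 2 : ℝ) • w t x -
          (1 / 2 : ℝ) • fderiv ℝ (w t) x x)‖ ≤ δ * Real.sqrt (-t) ^ 3) →
      ¬ (∀ r > 0, ∀ M : ℝ, ∃ t ∈ Set.Ioo (-(r ^ 2)) (0 : ℝ),
        ∃ x ∈ Metric.ball (0 : EuclideanSpace ℝ (Fin 3)) r, M < ‖w t x‖) := by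
  by_contra hcon
  push Not at hcon
  -- ## a contradiction sequence, mean-calm sub-balls rescaled to the slice `-1`
  have hk : ∀ k : ℕ, ∃ (v : ℝ → EuclideanSpace ℝ (Fin 3) → EuclideanSpace ℝ (Fin 3))
      (c : EuclideanSpace ℝ (Fin 3)),
      IsTypeIAncientMild C v ∧
      (∀ s : ℝ, s < 0 → ∫⁻ x, ‖fderiv ℝ (v s) x‖ₑ ^ 2 ≤ ENNReal.ofReal (K / Real.sqrt (-s))) ∧
      (∀ r > 0, ∀ M : ℝ, ∃ t ∈ Ioo (-(r ^ 2)) (0 : ℝ),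
        ∃ x ∈ ball (0 : EuclideanSpace ℝ (Fin 3)) r, M < ‖v t x‖) ∧
      c ∈ closedBall (0 : EuclideanSpace ℝ (Fin 3)) ρ ∧
      (∫ y in ball c r, ‖deriv (fun τ => v τ y) (-1) - (1 / 2 : ℝ) • v (-1) y -
          (1 / 2 : ℝ) • fderiv ℝ (v (-1)) y y‖ ≤ 1 / ((k : ℝ) + 1)) := by
    intro k
    obtain ⟨w, hw, hlaw, t, ht, x₀, hx₀, hcalm, hsing⟩ := hcon (1 / ((k : ℝ) + 1)) (by positivity)
    set μ : ℝ := Real.sqrt (-t) with hμdef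
    have hμ : 0 < μ := Real.sqrt_pos.2 (neg_pos.2 ht)
    have hμ3 : 0 < μ ^ 3 := by positivity
    -- the unsteadiness at time `t` as a field, and its `L¹` budget on the ball
    set F : EuclideanSpace ℝ (Fin 3) → EuclideanSpace ℝ (Fin 3) := fun x =>
      Real.sqrt (-t) • ((-t) • deriv (fun τ => w τ x) t - (1 / 2 : ℝ) • w t x -
        (1 / 2 : ℝ) • fderiv ℝ (w t) x x) with hFdef
    have hGv : (fun y => deriv (fun τ => nsRescale μ w τ y) (-1) -
        (1 / 2 : ℝ) • nsRescale μ w (-1) y -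
        (1 / 2 : ℝ) • fderiv ℝ (nsRescale μ w (-1)) y y) = fun y => F (μ • y) := by
      funext y
      rw [hμdef, unsteadiness_nsRescale hw ht y]
    refine ⟨nsRescale μ w, μ⁻¹ • x₀, isTypeIAncientMild_nsRescale hw hμ,
      RecurrentReductionD.dissipationLaw_nsRescale hlaw hμ,
      RecurrentReductionD.singularAtOrigin_nsRescale hsing hμ, ?_, ?_⟩
    · rw [mem_closedBall_zero_iff, norm_smul, norm_inv, Real.norm_of_nonneg hμ.le,
        inv_mul_le_iff₀ hμ, mul_comm]
      exact hx₀
    · -- change of variables `y = x/μ`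
      have hcv : ∫ y in ball (μ⁻¹ • x₀) r, ‖F (μ • y)‖ =
          (μ ^ 3)⁻¹ * ∫ x in ball x₀ (r * μ), ‖F x‖ := by
        have h := Measure.setIntegral_comp_smul_of_pos (μ := (volume : Measure
          (EuclideanSpace ℝ (Fin 3)))) (fun x => ‖F x‖) (ball (μ⁻¹ • x₀) r) hμ
        rw [finrank_euclideanSpace_fin, _root_.smul_ball hμ.ne', smul_smul, mul_inv_cancel₀ hμ.ne',
          one_smul, Real.norm_of_nonneg hμ.le, smul_eq_mul, mul_comm μ r] at h
        exact h
      have e : (fun y => ‖deriv (fun τ => nsRescale μ w τ y) (-1) -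
          (1 / 2 : ℝ) • nsRescale μ w (-1) y -
          (1 / 2 : ℝ) • fderiv ℝ (nsRescale μ w (-1)) y y‖) = fun y => ‖F (μ • y)‖ := by
        funext y; rw [congrFun hGv y]
      rw [show (∫ y in ball (μ⁻¹ • x₀) r, ‖deriv (fun τ => nsRescale μ w τ y) (-1) -
          (1 / 2 : ℝ) • nsRescale μ w (-1) y - (1 / 2 : ℝ) • fderiv ℝ (nsRescale μ w (-1)) y y‖) =
          ∫ y in ball (μ⁻¹ • x₀) r, ‖F (μ • y)‖ from by rw [e], hcv]
      have hcalm' : ∫ x in ball x₀ (r * μ), ‖F x‖ ≤ 1 / ((k : ℝ) + 1) * μ ^ 3 := hcalm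
      calc (μ ^ 3)⁻¹ * ∫ x in ball x₀ (r * μ), ‖F x‖
          ≤ (μ ^ 3)⁻¹ * (1 / ((k : ℝ) + 1) * μ ^ 3) :=
            mul_le_mul_of_nonneg_left hcalm' (inv_nonneg.2 hμ3.le)
        _ = 1 / ((k : ℝ) + 1) := by field_simp
  choose v c hv hlaw hsing hc hcalm using hk
  -- ## Bolzano for the centres, then compactness across members
  obtain ⟨cs, -, φ, hφ, hclim⟩ :=
    (isCompact_closedBall (0 : EuclideanSpace ℝ (Fin 3)) ρ).tendsto_subseq hc
  obtain ⟨ψ, hψ, W, hW, hunif, hpt, hgrad⟩ := Compactness.seqLimit (fun j => hv (φ j))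
  have hψt : Tendsto ψ atTop atTop := hψ.tendsto_atTop
  have hφψt : Tendsto (fun j => φ (ψ j)) atTop atTop := hφ.tendsto_atTop.comp hψt
  have hclim' : Tendsto (fun j => c (φ (ψ j))) atTop (𝓝 cs) := hclim.comp hψt
  have hWlaw : ∀ s : ℝ, s < 0 →
      ∫⁻ x, ‖fderiv ℝ (W s) x‖ₑ ^ 2 ≤ ENNReal.ofReal (K / Real.sqrt (-s)) :=
    Compactness.law_of_seqLimit (Kk := fun _ => K) (Kinf := K) (w := fun j => v (φ j)) hψt
      (fun j => hlaw (φ j)) (fun ε hε => Eventually.of_forall fun k => by linarith) hgrad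
  have hWsing := Compactness.persistent_singularity_seq (w := fun j => v (φ (ψ j)))
    (fun j => hv _) (fun j => hlaw _) (fun j => hsing _) hW hunif
  -- ## the weak unsteadiness of the limit slice vanishes on the tests supported in `B(c_*, r/2)`
  have hweak : ∀ χ : EuclideanSpace ℝ (Fin 3) → EuclideanSpace ℝ (Fin 3), ContDiff ℝ ∞ χ →
      HasCompactSupport χ → tsupport χ ⊆ ball cs (r / 2) → VectorCalculus.IsDivFree χ →
      ∫ y, (⟪W (-1) y, convect (W (-1)) χ y⟫ + ⟪W (-1) y, (Δ χ) y⟫ + ⟪W (-1) y, χ y⟫ +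
        (1 / 2 : ℝ) * ⟪W (-1) y, fderiv ℝ χ y y⟫) = 0 := by
    intro χ hχ hcχ hsuppχ hdiv
    have hχ2 : ContDiff ℝ 2 χ := contDiff_infty.1 hχ 2
    obtain ⟨Mχ, hMχ⟩ := hχ.continuous.bounded_above_of_compact_support hcχ
    have hM0 : 0 ≤ Mχ := (norm_nonneg _).trans (hMχ 0)
    have hlim := tendsto_weakUnsteadiness (v := fun j => v (φ (ψ j))) (W := W) (fun j => hv _)
      (hpt (-1) (by norm_num)) hχ2 hcχ
    have hev : ∀ᶠ j in atTop, ball cs (r / 2) ⊆ ball (c (φ (ψ j))) r := by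
      have hd : ∀ᶠ j in atTop, dist (c (φ (ψ j))) cs < r / 2 :=
        (tendsto_iff_dist_tendsto_zero.1 hclim').eventually (gt_mem_nhds (by positivity))
      filter_upwards [hd] with j hj
      intro y hy
      rw [mem_ball] at hy ⊢
      calc dist y (c (φ (ψ j))) ≤ dist y cs + dist cs (c (φ (ψ j))) := dist_triangle _ _ _
        _ < r / 2 + r / 2 := add_lt_add hy (by rwa [dist_comm])
        _ = r := by ring
    have hsmall : ∀ᶠ j in atTop, ‖∫ y, (⟪v (φ (ψ j)) (-1) y, convect (v (φ (ψ j)) (-1)) χ y⟫ +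
        ⟪v (φ (ψ j)) (-1) y, (Δ χ) y⟫ + ⟪v (φ (ψ j)) (-1) y, χ y⟫ +
        (1 / 2 : ℝ) * ⟪v (φ (ψ j)) (-1) y, fderiv ℝ χ y y⟫)‖ ≤
        (1 / (((φ (ψ j) : ℕ) : ℝ) + 1)) * Mχ := by
      filter_upwards [hev] with j hj
      rw [Real.norm_eq_abs]
      exact abs_weakUnsteadiness_le_of_meanCalm_ball (hv _) (hcalm (φ (ψ j))) hχ2 hcχ hdiv
        (hsuppχ.trans hj) hM0 hMχ
    have hzero : Tendsto (fun j => ∫ y, (⟪v (φ (ψ j)) (-1) y, convect (v (φ (ψ j)) (-1)) χ y⟫ +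
        ⟪v (φ (ψ j)) (-1) y, (Δ χ) y⟫ + ⟪v (φ (ψ j)) (-1) y, χ y⟫ +
        (1 / 2 : ℝ) * ⟪v (φ (ψ j)) (-1) y, fderiv ℝ χ y y⟫)) atTop (𝓝 0) := by
      refine squeeze_zero_norm' hsmall ?_
      have h0 : Tendsto (fun j => 1 / ((((φ (ψ j)) : ℕ) : ℝ) + 1)) atTop (𝓝 0) :=
        tendsto_one_div_add_atTop_nhds_zero_nat.comp hφψt
      simpa using h0.mul_const Mχ
    exact tendsto_nhds_unique hlim hzero
  -- ## the limit slice vanishes; forward uniqueness contradicts persistence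
  have hW0 : ∀ x, W (-1) x = 0 :=
    slice_eq_zero_of_weakSteady_on hW hWlaw isOpen_ball ⟨cs, mem_ball_self (by positivity)⟩ hweak
  exact not_singular_of_zero_slice hW (by norm_num) hW0 hWsing

/-- **PORTRAIT: the flicker carries definite `L¹`-mass in every parabolic sub-ball at every
instant.** For every SINGULAR member of `𝒟_{C,K}`, every instant `t < 0` and every centre
`‖x₀‖ ≤ ρ√(−t)`: `∫_{B(x₀, r√(−t))} ‖√(−t)((−t)∂ₜw − ½w − ½(x·∇)w)‖ dx > δ(C,K,ρ,r) (√(−t))³`, i.e.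
`∫_{B(c, r)} ‖∂ₛU‖ dy > δ` in similarity variables. -/
theorem meanFlicker_floor_of_singular (C K ρ r : ℝ) (hr : 0 < r) : ∃ δ > 0,
    ∀ (w : ℝ → EuclideanSpace ℝ (Fin 3) → EuclideanSpace ℝ (Fin 3)),
      IsTypeIAncientMild C w →
      (∀ s : ℝ, s < 0 → ∫⁻ x, ‖fderiv ℝ (w s) x‖ₑ ^ 2 ≤ ENNReal.ofReal (K / Real.sqrt (-s))) →
      (∀ r > 0, ∀ M : ℝ, ∃ t ∈ Set.Ioo (-(r ^ 2)) (0 : ℝ),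
        ∃ x ∈ Metric.ball (0 : EuclideanSpace ℝ (Fin 3)) r, M < ‖w t x‖) →
      ∀ t < 0, ∀ x₀ : EuclideanSpace ℝ (Fin 3), ‖x₀‖ ≤ ρ * Real.sqrt (-t) →
        δ * Real.sqrt (-t) ^ 3 < ∫ x in ball x₀ (r * Real.sqrt (-t)),
          ‖Real.sqrt (-t) • ((-t) • deriv (fun τ => w τ x) t - (1 / 2 : ℝ) • w t x -
            (1 / 2 : ℝ) • fderiv ℝ (w t) x x)‖ := by
  obtain ⟨δ, hδ, h⟩ := meanCalm_leaf C K ρ r hr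
  refine ⟨δ, hδ, fun w hw hlaw hsing t ht x₀ hx₀ => ?_⟩
  by_contra hnot
  push Not at hnot
  exact h w hw hlaw t ht x₀ hx₀ hnot hsing

end Summit.NavierStokesRegularity.NavierStokesRegularity.Theorems.FiniteDissipationLiouville.CalmSliceLocal

end
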